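import Literature.IUT.HodgeTheaters.InitialThetaDataTorsionCuspModelSupportInvariant
import Literature.IUT.HodgeTheaters.InitialThetaDataTorsionCuspModelModLCuspLaws
import Literature.IUT.HodgeTheaters.PiAvatarEvalSectionsLabelRigidCriterion
import Literature.IUT.HodgeTheaters.PiAvatarLocalDatumGood
import Literature.IUT.HodgeTheaters.PiAvatarLocalArrowLawOfTorsionMonodromy
import Literature.IUT.HodgeTheaters.InitialThetaDataLocalGalois
import Literature.FieldTheory.Galois.AbsoluteGaloisZModQuotient
import HarnessLib

/-!
# [IUTchI] Example 4.4 (i)/(iv): the EVALUATION-SECTION BINDER `EvalSectionBinder` INHABITED from a `ℤ/l`-character — (A1) MODEL-AGNOSTIC over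
# an abstract local datum of any initial Θ-datum whose ambient is the group-ring two-step model, (A2) the instance at the good-place local
# datum of `regeom₃` with the cyclotomic character of `G_K` (NV-L5 row «EVALSECT-NV/A WITNESS@regeom₃», part 2 of 2; definitions + ∃-statements)

S. Mochizuki, *Inter-universal Teichmüller theory I*, kurims manuscript (May 2020), Example 4.4 (i) p. 106 l. 22–27 «the various
sections `G_v → Π_v = Π^tp_{X̲̲_v}` of the natural surjection `Π_v ↠ G_v` that arise from the evaluation points. In the following, we
shall refer to these sections as the evaluation sections … each evaluation section has an associated label `∈ |𝔽_l|`», (iv) p. 107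
l. 9–10 «each of these labels can only be well-defined up to multiplication by ±1» ([IUTchI] Ex 4.4 (i) p.106) [claim: Mochizuki2012,
status: disputed] (D-0012 claim key; series status DISPUTED — an NV witness for abc-iut-L5-t3's binder `EvalSectionBinder` (p456293) at
abc-iut-L5-t8's MODEL (`TorsionCuspModel`, stage B parts B1–B5a, `regeom₃`); nothing of the series is asserted; no side taken on [IUTchIII] Cor. 3.12).

## WHAT (abc-iut-L5-lead gen 7 RULINGS #88 (2), #91 (1) (n1)(n2), #92 (3), #93 (3); part 1 = `InitialThetaDataTorsionCuspModelSupportInvariant.lean`)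

§A1 MODEL-AGNOSTIC (RULINGS #93 (3) layer (A1)) — for ANY initial Θ-datum `D`, ANY `CG`, `hS`, ANY local datum `δ : D.LocalDatum CG hS`, an
identification `ι : (U ⋊ T) ⋊ (G_F × {±1}) ≃* Π_{C_F}(D)` reading the augmentation off the `G_F`-coordinate (`hι`; `ι := id` at every
re-geometrisation onto the model group: `regeom₃`, the stage-C `regeom₄`), `Gv` fixing the `l`-torsion (`hK`), a character `χ : Gv →* ℤ/l`, and
`|𝔽_l|` `U`-vectors `w_j` with `ι⟨(w_j^k, 1), (σ, 1)⟩ ∈ δ.H` (`σ ∈ Gv`) and `δ.H` lying over `Gv`: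
* `TorsionCuspModel.sectOfChar w χ : Gv →* Π_{C_F}`, `σ ↦ ⟨(w^{χ(σ)}, 1), (σ, 1)⟩` (a homomorphism: `Gv` centralises `Del`);
* **`evalSectionsOfChar`** (the DATA binder), **`suppInv_comap_range_evalHom_ofChar`**: `I(Im_j) = {0, #supp(w_j)}` for `χ ≠ 1` with
  `I S := suppInv (ι⁻¹ S)`; **`labelRigid_evalSectionsOfChar`** := abc-iut-L5-t3's `labelRigid_of_invariant I hI hsep` (`hI` for ALL `n ∈ Π_{C_F}` by
  `suppInv_conj` ∘ `comap_conj_smul`; `hsep` ⟸ `χ ≠ 1` and `j ↦ #supp(w_j)` injective) — NO `thetaClass`/outer-hom reasoning;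
  **`evalSectionBinderOfChar`**, **`nonempty_evalSectionBinder_of_character`**.
§A2 AT `regeom₃` (`ι := MulEquiv.refl`, binders `hS`, `hA` of stage B — `hS` has NO term at `regeom₃` (RULINGS #93 (1)); layer (A2) proper =
the same one-liner at `regeom₄`/`localDataStandIn` after stage C4):
* `labelCode : |𝔽_l| → {0..l⋇}`; **`uElt_mem_PiXarrow_regeom₃`**: `⟨(u,1),(σ,1)⟩ ∈ Π_{X̲→_K}(regeom₃)` for `u ∈ I_{ℤ·g}·U`, `σ ∈ G_K` — abc-iut-L5-t8's
  `embU_mem_modLKer₃_of_mem_cob` + the GENERIC chain `Ker(Δ_X̲ ↠ Δ_X̲^{ab} ⊗ 𝔽_l) ≤ jKer ≤ Π_{X→} = D_{2ε} ⊔ jKer ∋ (σ, 1)` of abc-iut-L5-t1's §1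
  construction (NO stage-B B5b/B6 input); `suppCard_cobVec_labelCode_injective` (`w_j := cobVec g code(j)`, `#supp = 2·code(j)`);
* `localDatumRegeom₃ hS hA Gv` := abc-iut-L5-t4's `LocalDatum.ofGood` with the derived Λ of abc-iut-L5-d5/t8 (`M′ = unramifiedTorsionMonodromyRegeom₃`,
  `hA`, `hI`) — the SAME local group `Π_{X̲→_K} ∩ augGF⁻¹ Gv` as the bad-place component `localDataStandIn … v` (= `localDataOfBadPairs … (badPairAtArrow
  hA) …`, a sibling `LocalDatum` constructor of the same family) at `Gv := decompAt v` (RULINGS #91 (1) (n2), #92 (3));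
* **`exists_evalSectionBinder_regeom₃_of_character (hS) (hA) (hGv : Gv ≤ G_K) (χ) (hχ : χ ≠ 1)`** and **`nonempty_evalSectionBinder_regeom₃ (hS) (hA)`**
  with `Gv := G_K` and `χ` := the cyclotomic `ℤ/l`-character of `Literature.FieldTheory.Galois.exists_surjective_monoidHom_zmod` (p465974) along
  `galoisSubgroupOfEquiv` (`exists_character_galoisSubgroupOf_ne_one`); and **`nonempty_evalSectionBinder_regeom₃_of_hS (hS)`** — `hA` DISCHARGED by
  abc-iut-L5-t8's B6 `arrowCoveringClaimsRegeom₃` (p469075), leaving the SINGLE binder `hS` (no term at `regeom₃`, RULINGS #93 (1)).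

HONEST TAGS (RULINGS #88 (2) / #91 (1) (n1)): /A «NV modulo the §6 binders hS, hA at regeom₃ and a ℤ/l-character of (a subgroup of) G_K nontrivial
on augGF(Π_v̲) = Gv»; /A∘/B «NV at regeom₃ + good-place LocalDatum over Gv := G_K (the model's WHOLE arithmetic Galois group); sections =
coboundary twists u_{code(j)}^{χ(σ)} by a cyclotomic ℤ/l-character of G_K; LabelRigid via an N(Π_v̲)-invariant of U-coordinates».  At a
DECOMPOSITION subgroup `D_v ≤ G_K` (`decompAt v`) the same construction needs `χ|_{D_v} ≠ 1`, i.e. `v` not split in the degree-`l` layer of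
`K(ζ_{l^∞})/K` — NOT claimed for every `v`.  A model inhabits OUR binders only: nothing about print's evaluation points, theta values or
[EtTh] Cor 2.9; typed ≠ inhabited ≠ discharged; instantiated ≠ endorsed; no `Nonempty` conjunct is offered to any certificate before the lead's
§E census; no side taken on [IUTchIII] Cor. 3.12.  No instance, no notation.
-/

noncomputable section

namespace Literature.IUT.HodgeTheaters

universe u

/-! ## §A1 MODEL-AGNOSTIC: evaluation sections from a `ℤ/l`-character over an ABSTRACT local datum `δ` of ANY datum `D` whose
## ambient is identified with the model group `Π_{C_F} = (U ⋊ T) ⋊ (G_F × {±1})` by `ι` -/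

section ModelAgnostic

open TorsionCuspModel TorsionMonodromyModel
open scoped Pointwise

variable {F K Fbar : Type u} [Field F] [NumberField F] [Field K] [NumberField K] [Algebra F K] [Field Fbar]
  [Algebra F Fbar] [Algebra K Fbar] {E : WeierstrassCurve F} [E.IsElliptic] {l : ℕ} {Pb : BadPlacePredicates K}
  [Fact l.Prime]

namespace TorsionCuspModel

section SectOfChar

variable {F₁ : Type u} [Field F₁] {E₁ : WeierstrassCurve F₁} {Fbar₁ : Type u} [Field Fbar₁] [Algebra F₁ Fbar₁] {l₁ : ℕ} [NeZero l₁]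
  {Gv : Subgroup (Fbar₁ ≃ₐ[F₁] Fbar₁)} (hK : ∀ σ ∈ Gv, FixesTorsion E₁ l₁ σ) (χ : ↥Gv →* Multiplicative (ZMod l₁))

/-- **`sectOfChar w χ : Gv →* Π_{C_F}`, `σ ↦ ⟨(w^{χ(σ)}, 1), (σ, 1)⟩`** — a HOMOMORPHISM because `Gv` fixes the `l`-torsion, hence
centralises `Del` (`outer_eq_one_of_fixesTorsion`). ([IUTchI] Ex 4.4 (i) p.106) [claim: Mochizuki2012, status: disputed] -/
def sectOfChar (w : U E₁ Fbar₁ l₁) : ↥Gv →* TorsionCuspModel.PiC F₁ E₁ Fbar₁ l₁ where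
  toFun σ := uElt (w ^ expOf χ σ) (σ : Fbar₁ ≃ₐ[F₁] Fbar₁)
  map_one' := by
    rw [expOf, map_one, toAdd_one, ZMod.val_zero, pow_zero, OneMemClass.coe_one, uElt_one_one]
  map_mul' σ τ := by
    rw [uElt_mul_uElt (hK _ σ.2), ← pow_add, Subgroup.coe_mul]
    congr 1
    rw [expOf, map_mul, toAdd_mul, ZMod.val_add, ← U.pow_eq_pow_mod, expOf, expOf]

/-- Value of `sectOfChar`. ([IUTchI] Ex 4.4 (i) p.106) [claim: Mochizuki2012, status: disputed] -/
theorem sectOfChar_apply (w : U E₁ Fbar₁ l₁) (σ : ↥Gv) :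
    sectOfChar hK χ w σ = uElt (w ^ expOf χ σ) (σ : Fbar₁ ≃ₐ[F₁] Fbar₁) := rfl

end SectOfChar

/-- Pulling back a conjugate along a group isomorphism conjugates the pull-back. [cite: Mochizuki2012, IUTchI Def 3.1 (b)(c) p.61–62] -/
theorem comap_conj_smul {A B : Type*} [Group A] [Group B] (ι : A ≃* B) (n : B) (S : Subgroup B) :
    (MulAut.conj n • S).comap ι.toMonoidHom = MulAut.conj (ι.symm n) • S.comap ι.toMonoidHom := by
  ext x
  simp only [Subgroup.mem_comap, Subgroup.mem_pointwise_smul_iff_inv_smul_mem, MulEquiv.coe_toMonoidHom,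
    MulAut.smul_def, MulAut.conj_inv_apply, map_mul, map_inv, MulEquiv.apply_symm_apply]

end TorsionCuspModel

namespace InitialThetaData

variable {D : InitialThetaData F K Fbar E l Pb} {CG : D.geom.pe.CuspGalois} {hS : D.CuspClassesNormaliserStable}
  (δ : D.LocalDatum CG hS) (ι : TorsionCuspModel.PiC F E Fbar l ≃* D.PiC) (hι : ∀ x, D.augGF (ι x) = x.right.1)
  {Gv : Subgroup (Fbar ≃ₐ[F] Fbar)} (hK : ∀ σ ∈ Gv, FixesTorsion E l σ) (χ : ↥Gv →* Multiplicative (ZMod l))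
  (w : FlAbs l → U E Fbar l) (hmem : ∀ (j : FlAbs l) (k : ℕ) (σ : ↥Gv), ι (uElt (w j ^ k) (σ : Fbar ≃ₐ[F] Fbar)) ∈ δ.H)
  (haug : ∀ x ∈ δ.H, D.augGF x ∈ Gv)

/-- **Example 4.4 (i)'s DATA binder from a character** (model-agnostic form): over ANY local datum `δ` of ANY initial Θ-datum `D` whose
ambient `Π_{C_F}` is identified with the model group by `ι` (reading the augmentation off the `G_F`-coordinate), with `Gv` fixing the
`l`-torsion, `χ : Gv → ℤ/l`, and `U`-vectors `w_j` all of whose powers give elements `ι⟨(w_j^k,1),(σ,1)⟩ ∈ Π_v̲ = δ.H` (`σ ∈ Gv`), `Π_v̲` lying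
over `Gv`: `s_j := ι ∘ sectOfChar w_j χ`. ([IUTchI] Ex 4.4 (i) p.106) [claim: Mochizuki2012, status: disputed] -/
def evalSectionsOfChar : EvalSections δ Gv where
  sect j := ι.toMonoidHom.comp (sectOfChar hK χ (w j))
  sect_mem j σ := hmem j _ σ
  aug_sect j σ := by
    rw [MonoidHom.comp_apply, MulEquiv.coe_toMonoidHom, sectOfChar_apply, hι]
    rfl
  aug_mem := haug

/-- **The image invariant of `s_j`**: with `I S := suppInv (ι⁻¹ S)`, `I(Im_j) = {0, #supp(w_j)}` as soon as `χ ≠ 1`.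
([IUTchI] Ex 4.4 (iv) p.107) [claim: Mochizuki2012, status: disputed] -/
theorem suppInv_comap_range_evalHom_ofChar (hχ : χ ≠ 1) (j : FlAbs l) :
    suppInv ((((evalSectionsOfChar δ ι hι hK χ w hmem haug).evalHom j).range.map δ.H.subtype).comap ι.toMonoidHom) =
      {0, suppCard (w j)} := by
  set ES := evalSectionsOfChar δ ι hι hK χ w hmem haug with hES
  ext k
  constructor
  · rintro ⟨u, σ, -, hm, rfl⟩
    rw [Subgroup.mem_comap] at hm
    obtain ⟨x, hx⟩ := (EvalSections.mem_map_range_evalHom_iff ES).mp hm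
    rw [show ES.sect j = ι.toMonoidHom.comp (sectOfChar hK χ (w j)) from rfl, MonoidHom.comp_apply,
      MulEquiv.coe_toMonoidHom, ι.apply_eq_iff_eq, sectOfChar_apply] at hx
    obtain ⟨hu, -⟩ := uElt_inj hx
    rw [← hu]
    by_cases h0 : ((expOf χ ⟨D.augGF x, ES.aug_mem x x.2⟩ : ℕ) : ZMod l) = 0
    · exact Or.inl (suppCard_pow_of_eq_zero _ h0)
    · exact Or.inr (by rw [Set.mem_singleton_iff, suppCard_pow _ h0])
  · intro hk
    rcases hk with rfl | rfl
    · refine ⟨1, 1, fixesTorsion_one, ?_, suppCard_one⟩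
      rw [Subgroup.mem_comap, MulEquiv.coe_toMonoidHom, uElt_one_one, map_one]
      exact one_mem _
    · obtain ⟨σ₀, hσ₀⟩ : ∃ σ₀ : ↥Gv, χ σ₀ ≠ 1 := by
        by_contra h
        exact hχ (MonoidHom.ext fun σ => not_not.mp (not_exists.mp h σ))
      have hmemH : ι (uElt (w j ^ expOf χ σ₀) (σ₀ : Fbar ≃ₐ[F] Fbar)) ∈ δ.H := hmem j _ σ₀
      refine ⟨w j ^ expOf χ σ₀, σ₀, hK _ σ₀.2, ?_, ?_⟩
      · rw [Subgroup.mem_comap, MulEquiv.coe_toMonoidHom]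
        refine OuterHom.mem_map_range_iff.mpr ⟨⟨_, hmemH⟩, ?_⟩
        have key : ∀ τ : ↥Gv, τ = σ₀ → ((ES.sect j) τ : D.PiC) = ι (uElt (w j ^ expOf χ σ₀) σ₀) := by
          rintro τ rfl; rfl
        exact key _ (Subtype.ext (by
          show D.augGF (ι (uElt (w j ^ expOf χ σ₀) (σ₀ : Fbar ≃ₐ[F] Fbar))) = _
          rw [hι]
          rfl))
      · have hne : ((expOf χ σ₀ : ℕ) : ZMod l) ≠ 0 := by
          rw [natCast_expOf]
          intro h
          exact hσ₀ (by rw [← ofAdd_toAdd (χ σ₀), h, ofAdd_zero])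
        rw [suppCard_pow _ hne]

/-- **LABEL RIGIDITY from a character** (model-agnostic form), via abc-iut-L5-t3's `labelRigid_of_invariant` with `I S := suppInv (ι⁻¹ S)` —
invariant under conjugation by EVERY `n ∈ Π_{C_F}` (`suppInv_conj` ∘ `comap_conj_smul`) — as soon as `χ ≠ 1` and the support sizes `#supp(w_j)`
are pairwise distinct (a zero size is allowed once). No `thetaClass`/outer-hom reasoning. ([IUTchI] Ex 4.4 (iv) p.107) [claim: Mochizuki2012, status: disputed] -/
theorem labelRigid_evalSectionsOfChar (hχ : χ ≠ 1) (hw : Function.Injective fun j => suppCard (w j)) :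
    (evalSectionsOfChar δ ι hι hK χ w hmem haug).LabelRigid := by
  refine (evalSectionsOfChar δ ι hι hK χ w hmem haug).labelRigid_of_invariant
    (fun S => suppInv (S.comap ι.toMonoidHom)) (fun S n _ => by simp only [comap_conj_smul, suppInv_conj]) ?_
  intro j j' h
  have key : ({0, suppCard (w j)} : Set ℕ) = {0, suppCard (w j')} := by
    rw [← suppInv_comap_range_evalHom_ofChar δ ι hι hK χ w hmem haug hχ j,
      ← suppInv_comap_range_evalHom_ofChar δ ι hι hK χ w hmem haug hχ j']
    exact h
  apply hw
  have h1 : suppCard (w j) ∈ ({0, suppCard (w j')} : Set ℕ) := by rw [← key]; exact Or.inr rfl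
  have h2 : suppCard (w j') ∈ ({0, suppCard (w j)} : Set ℕ) := by rw [key]; exact Or.inr rfl
  rcases h1 with h1 | h1 <;> rcases h2 with h2 | h2 <;> (try rw [Set.mem_singleton_iff] at h1) <;>
    (try rw [Set.mem_singleton_iff] at h2) <;> simp only at h1 h2 ⊢ <;> omega

/-- **Example 4.4's `EvalSectionBinder` from a character** (model-agnostic form). ([IUTchI] Ex 4.4 (i) p.106) [claim: Mochizuki2012, status: disputed] -/
def evalSectionBinderOfChar (hχ : χ ≠ 1) (hw : Function.Injective fun j => suppCard (w j)) : EvalSectionBinder δ Gv :=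
  { toEvalSections := evalSectionsOfChar δ ι hι hK χ w hmem haug
    label_rigid := labelRigid_evalSectionsOfChar δ ι hι hK χ w hmem haug hχ hw }

/-- **EVALSECT-NV (A1), model-agnostic**: `EvalSectionBinder δ Gv` is INHABITED for every local datum `δ` of every initial Θ-datum whose ambient is
the model `Π_{C_F}` (via `ι`), given `Gv` fixing the torsion, a character `χ ≠ 1` of `Gv`, and `|𝔽_l|` `U`-vectors of pairwise distinct support
size all of whose powers twist into `δ.H` over `Gv`, `δ.H` lying over `Gv`. ([IUTchI] Ex 4.4 (i) p.106) [claim: Mochizuki2012, status: disputed] -/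
theorem nonempty_evalSectionBinder_of_character {D : InitialThetaData F K Fbar E l Pb} {CG : D.geom.pe.CuspGalois}
    {hS : D.CuspClassesNormaliserStable} (δ : D.LocalDatum CG hS) (ι : TorsionCuspModel.PiC F E Fbar l ≃* D.PiC)
    (hι : ∀ x, D.augGF (ι x) = x.right.1) {Gv : Subgroup (Fbar ≃ₐ[F] Fbar)} (hK : ∀ σ ∈ Gv, FixesTorsion E l σ)
    (χ : ↥Gv →* Multiplicative (ZMod l)) (w : FlAbs l → U E Fbar l)
    (hmem : ∀ (j : FlAbs l) (k : ℕ) (σ : ↥Gv), ι (uElt (w j ^ k) (σ : Fbar ≃ₐ[F] Fbar)) ∈ δ.H)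
    (haug : ∀ x ∈ δ.H, D.augGF x ∈ Gv) (hχ : χ ≠ 1) (hw : Function.Injective fun j => suppCard (w j)) :
    Nonempty (EvalSectionBinder δ Gv) :=
  ⟨evalSectionBinderOfChar δ ι hι hK χ w hmem haug hχ hw⟩

end InitialThetaData

end ModelAgnostic

/-! ## §A2 The instance at `regeom₃` (binders `hS`, `hA` of stage B; `ι := id`) -/

section Regeom3

open TorsionCuspModel TorsionMonodromyModel
open scoped Pointwise

variable {F K Fbar : Type u} [Field F] [NumberField F] [Field K] [NumberField K] [Algebra F K] [Field Fbar]
  [Algebra F Fbar] [Algebra K Fbar] {E : WeierstrassCurve F} [E.IsElliptic] {l : ℕ} {Pb : BadPlacePredicates K}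
  [Fact l.Prime]

namespace InitialThetaData

/-- A numbering of the labels `|𝔽_l| = {0, 1, …, l⋇}` by `{0, …, l⋇}` (any bijection with `Fin (l⋇+1)`). ([IUTchI] Ex 4.4 (iv) p.107) [claim: Mochizuki2012, status: disputed] -/
def labelCode (j : FlAbs l) : ℕ :=
  haveI : Finite (FlAbs l) := Finite.of_surjective _ (FlAbs.mk_surjective l)
  (Finite.equivFin (FlAbs l) j).val

/-- The numbering is injective. ([IUTchI] Ex 4.4 (iv) p.107) [claim: Mochizuki2012, status: disputed] -/
theorem labelCode_injective : Function.Injective (labelCode (l := l)) := by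
  haveI : Finite (FlAbs l) := Finite.of_surjective _ (FlAbs.mk_surjective l)
  intro j j' h
  exact (Finite.equivFin (FlAbs l)).injective (Fin.ext h)

/-- `2 · code(j) ≤ l - 1` for `l ≠ 2`. ([IUTchI] Ex 4.4 (iv) p.107) [claim: Mochizuki2012, status: disputed] -/
theorem two_mul_labelCode_le (hl2 : l ≠ 2) (j : FlAbs l) : 2 * labelCode j ≤ l - 1 := by
  haveI : Finite (FlAbs l) := Finite.of_surjective _ (FlAbs.mk_surjective l)
  have h1 : labelCode j < Nat.card (FlAbs l) := (Finite.equivFin (FlAbs l) j).isLt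
  rw [card_flAbs l hl2, lStar] at h1
  omega

variable (D₀ : InitialThetaData F K Fbar E l Pb)

omit [Fact l.Prime] in
/-- `l ≠ 2` for an initial Θ-datum (`l ≥ 5`). [cite: Mochizuki2012, IUTchI Def 3.1 (c) p.62] -/
theorem l_ne_two' (D₀ : InitialThetaData F K Fbar E l Pb) : l ≠ 2 := by have := D₀.five_le_l; omega

omit [Fact l.Prime] in
/-- The augmentation of `regeom₃` reads the `G_F`-coordinate (the `hι` of §A1 for `ι := id`). [cite: Mochizuki2012, IUTchI Def 3.1 (b)(c) p.61–62] -/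
theorem augGF_regeom₃ (x : TorsionCuspModel.PiC F E Fbar l) : D₀.regeom₃.augGF (x : D₀.regeom₃.PiC) = x.right.1 := rfl

/-- **`H`-MEMBERSHIP at `regeom₃`**: `⟨(u,1),(σ,1)⟩ ∈ Π_{X̲→_K}(regeom₃)` for every coboundary vector `u ∈ I_{ℤ·g}·U` (abc-iut-L5-t8's
`embU_mem_modLKer₃_of_mem_cob`: `(u,1) ∈ Ker(Δ_X̲ ↠ Δ_X̲^{ab} ⊗ 𝔽_l) ≤ jKer ≤ Π_{X→}`, GENERIC inclusions of abc-iut-L5-t1's §1 construction)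
and every `σ ∈ G_K` (`(σ,1) ∈ D_{2ε} ≤ Π_{X→}`). ([IUTchI] Ex 4.4 (i) p.106) [claim: Mochizuki2012, status: disputed] -/
theorem uElt_mem_PiXarrow_regeom₃ {u : U E Fbar l} (hu : u ∈ cob (E := E) D₀.lineGen) {σ : Fbar ≃ₐ[F] Fbar}
    (hσ : σ ∈ galoisSubgroupOf F K Fbar) : (uElt u σ : D₀.regeom₃.PiC) ∈ D₀.regeom₃.PiXarrow := by
  haveI := D₀.isAlgClosure
  haveI := D₀.isScalarTower
  haveI : CompactSpace (galoisSubgroupOf F K Fbar) :=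
    isCompact_iff_compactSpace.mp (ThetaGeometryModel.isClosed_galoisSubgroupOf F K Fbar).isCompact
  have h1 : (uElt u 1 : D₀.regeom₃.PiC) ∈ D₀.regeom₃.PiXarrow := by
    refine ⟨embU (galoisSubgroupOf F K Fbar) u, ?_, ?_⟩
    · have hm := embU_mem_modLKer₃_of_mem_cob (F := F) (galoisSubgroupOf F K Fbar) Quotient.out
        (D₀.coGen ^ ((l + 1) / 2)) D₀.coGen D₀.l_prime D₀.coGen_not_mem D₀.five_le_l
        (coprime_six_of_prime l D₀.l_prime D₀.five_le_l) hu
      exact Subgroup.mem_sup_right (Subgroup.mem_sup_left (Subgroup.mem_sup_left hm))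
    · rfl
  have h2 : (uElt 1 σ : D₀.regeom₃.PiC) ∈ D₀.regeom₃.PiXarrow := by
    refine ⟨(⟨σ, hσ⟩, 1), Subgroup.mem_sup_left (mem_liftU.mpr (one_mem _)), ?_⟩
    show (⟨(1 : DihU F E Fbar l).left, (σ, (1 : DihU F E Fbar l).right)⟩ : TorsionCuspModel.PiC F E Fbar l) = uElt 1 σ
    rw [uElt, map_one]
    rfl
  have h3 : uElt u σ = uElt u 1 * uElt 1 σ := by
    rw [uElt_mul_uElt fixesTorsion_one, mul_one, one_mul]
  rw [h3]
  exact mul_mem h1 h2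

/-- The label vectors at `regeom₃`: `w_j := cobVec g code(j)` with `#supp(w_j) = 2·code(j)` pairwise distinct.
([IUTchI] Ex 4.4 (iv) p.107) [claim: Mochizuki2012, status: disputed] -/
theorem suppCard_cobVec_labelCode_injective :
    Function.Injective fun j : FlAbs l => suppCard (cobVec D₀.lineGen (labelCode j)) := by
  intro j j' h
  simp only at h
  rw [suppCard_cobVec (Tors.orderOf_eq D₀.l_prime D₀.lineGen_ne_one) ((two_mul_labelCode_le D₀.l_ne_two' j).trans (Nat.sub_le l 1)),
    suppCard_cobVec (Tors.orderOf_eq D₀.l_prime D₀.lineGen_ne_one) ((two_mul_labelCode_le D₀.l_ne_two' j').trans (Nat.sub_le l 1))] at h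
  exact labelCode_injective (by omega)

/-- The derived local arrow law of the good place over `Gv` at `regeom₃` (abc-iut-L5-d5/t8, fed with `M′`, `hA`, `hI`).
([IUTchI] Def 6.1 (iii) p.157) [claim: Mochizuki2012, status: disputed] -/
theorem localArrowLaw_regeom₃ (hS : D₀.regeom₃.CuspClassesNormaliserStable)
    (hA : D₀.regeom₃.geom.pe.ArrowCoveringClaims) (Gv : Subgroup (Fbar ≃ₐ[F] Fbar)) :
    D₀.regeom₃.LocalArrowLaw D₀.cuspGaloisRegeom₃ hS (D₀.regeom₃.PiXarrow ⊓ Gv.comap D₀.regeom₃.augGF) :=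
  InitialThetaData.localArrowLaw_local_of_torsionMonodromy D₀.cuspGaloisRegeom₃ hS
    D₀.unramifiedTorsionMonodromyRegeom₃.toTorsionMonodromy hA (D₀.unramifiedTorsionMonodromyRegeom₃.tau_inertia _) Gv

/-- **The good-place local datum of `regeom₃` over `Gv`** (`Π_v̲ := Π_{X̲→_K} ∩ augGF⁻¹ Gv`; abc-iut-L5-t4's `LocalDatum.ofGood` — the SAME local group
as the bad-place component `localDataStandIn … v` of the Θ-NF stand-in kit at `Gv := decompAt v`, a sibling constructor of the same family).
([IUTchI] Def 6.1 (ii) p.156) [claim: Mochizuki2012, status: disputed] -/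
def localDatumRegeom₃ (hS : D₀.regeom₃.CuspClassesNormaliserStable) (hA : D₀.regeom₃.geom.pe.ArrowCoveringClaims)
    (Gv : Subgroup (Fbar ≃ₐ[F] Fbar)) : D₀.regeom₃.LocalDatum D₀.cuspGaloisRegeom₃ hS :=
  LocalDatum.ofGood Gv (D₀.localArrowLaw_regeom₃ hS hA Gv) hA

/-- Its local group. ([IUTchI] Def 6.1 (ii) p.156) [claim: Mochizuki2012, status: disputed] -/
@[simp] theorem localDatumRegeom₃_H (hS : D₀.regeom₃.CuspClassesNormaliserStable)
    (hA : D₀.regeom₃.geom.pe.ArrowCoveringClaims) (Gv : Subgroup (Fbar ≃ₐ[F] Fbar)) :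
    (D₀.localDatumRegeom₃ hS hA Gv).H = D₀.regeom₃.PiXarrow ⊓ Gv.comap D₀.regeom₃.augGF := rfl

/-- **EVALSECT-NV /A at `regeom₃`** (relative form; §A1 at `ι := id`, `δ :=` the good-place datum over `Gv ≤ G_K`, `w_j := cobVec g code(j)`): MODULO the
§6 binders `hS`, `hA` at `regeom₃` and a `ℤ/l`-character `χ ≠ 1` of `Gv`, `EvalSectionBinder` is INHABITED at a local datum whose local group lies over
EXACTLY `G_K ∩ Gv = Gv` (abc-iut-L5-t3 (R3): «χ nontrivial on augGF(Π_v̲)» IS `χ ≠ 1`). ([IUTchI] Ex 4.4 (i) p.106) [claim: Mochizuki2012, status: disputed] -/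
theorem exists_evalSectionBinder_regeom₃_of_character (hS : D₀.regeom₃.CuspClassesNormaliserStable)
    (hA : D₀.regeom₃.geom.pe.ArrowCoveringClaims) {Gv : Subgroup (Fbar ≃ₐ[F] Fbar)} (hGv : Gv ≤ galoisSubgroupOf F K Fbar)
    (χ : ↥Gv →* Multiplicative (ZMod l)) (hχ : χ ≠ 1) :
    ∃ δ : D₀.regeom₃.LocalDatum D₀.cuspGaloisRegeom₃ hS,
      δ.H = D₀.regeom₃.PiXarrow ⊓ Gv.comap D₀.regeom₃.augGF ∧ Nonempty (EvalSectionBinder δ Gv) :=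
  ⟨D₀.localDatumRegeom₃ hS hA Gv, rfl,
    nonempty_evalSectionBinder_of_character (D₀.localDatumRegeom₃ hS hA Gv) (MulEquiv.refl _) (D₀.augGF_regeom₃)
      (fun σ hσ => D₀.fixesTorsion_of_mem_galoisSubgroupOf σ (hGv hσ)) χ (fun j => cobVec D₀.lineGen (labelCode j))
      (fun _ k σ => ⟨D₀.uElt_mem_PiXarrow_regeom₃ (Subgroup.pow_mem _ (cobVec_mem_cob _ _) k) (hGv σ.2), σ.2⟩)
      (fun _ hx => hx.2) hχ D₀.suppCard_cobVec_labelCode_injective⟩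

/-- A `ℤ/l`-character of `G_K`, transported along `Gal(F̄/K) ≃* G_K` from the CYCLOTOMIC one of
`Literature.FieldTheory.Galois.exists_surjective_monoidHom_zmod` (first layer of the cyclotomic `ℤ_l`-extension), nontrivial because onto.
[cite: Lang1990, Ch. 5 §4, PDF p. 102] -/
theorem exists_character_galoisSubgroupOf_ne_one (D₀ : InitialThetaData F K Fbar E l Pb) :
    ∃ χ : ↥(galoisSubgroupOf F K Fbar) →* Multiplicative (ZMod l), χ ≠ 1 := by
  haveI := D₀.isAlgClosure
  haveI := D₀.isScalarTower
  haveI : IsAlgClosed Fbar := IsAlgClosure.isAlgClosed F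
  haveI : Algebra.IsAlgebraic K Fbar := Algebra.IsAlgebraic.tower_top (K := F) K
  haveI : CharZero Fbar := charZero_of_injective_algebraMap (algebraMap F Fbar).injective
  obtain ⟨χ, hχ⟩ := Literature.FieldTheory.Galois.exists_surjective_monoidHom_zmod K Fbar l D₀.l_ne_two'
  refine ⟨χ.comp (galoisSubgroupOfEquiv F K Fbar).symm.toMonoidHom, fun h => ?_⟩
  obtain ⟨σ, hσ⟩ := hχ (Multiplicative.ofAdd 1)
  have h1 : χ.comp (galoisSubgroupOfEquiv F K Fbar).symm.toMonoidHom (galoisSubgroupOfEquiv F K Fbar σ) = 1 := by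
    rw [h, MonoidHom.one_apply]
  rw [MonoidHom.comp_apply, MulEquiv.coe_toMonoidHom, MulEquiv.symm_apply_apply, hσ] at h1
  have h2 : (1 : ZMod l) = 0 := by simpa using congrArg Multiplicative.toAdd h1
  exact one_ne_zero h2

/-- **EVALSECT-NV /A∘/B at `regeom₃`** (MODULO the stage-B binders `hS`, `hA` only): `EvalSectionBinder` is INHABITED at the good-place local datum of
`regeom₃` over `Gv := G_K` — THE WHOLE arithmetic Galois group of the model (at a DECOMPOSITION subgroup `D_v ≤ G_K`, e.g. abc-iut-L5-t4's
`decompAt v` in the binder of record `EvalSectionBinder (localDataStandIn … v) (decompAt v)`, the same construction needs `χ|_{D_v} ≠ 1`, i.e. `v` not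
split in the degree-`l` layer of `K(ζ_{l^∞})/K` — NOT claimed here for every `v`).  Sections = coboundary twists `⟨(u_{code(j)}^{χ(σ)}, 1), (σ, 1)⟩` by the
cyclotomic `ℤ/l`-character of `G_K` (p465974); `LabelRigid` via the `N(Π_v̲)`-invariant «support sizes of `U`-coordinate vectors».  No `Nonempty`
conjunct is offered to any certificate before the lead's §E census. ([IUTchI] Ex 4.4 (i) p.106) [claim: Mochizuki2012, status: disputed] -/
theorem nonempty_evalSectionBinder_regeom₃ (hS : D₀.regeom₃.CuspClassesNormaliserStable)
    (hA : D₀.regeom₃.geom.pe.ArrowCoveringClaims) :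
    ∃ δ : D₀.regeom₃.LocalDatum D₀.cuspGaloisRegeom₃ hS,
      δ.H = D₀.regeom₃.PiXarrow ⊓ (galoisSubgroupOf F K Fbar).comap D₀.regeom₃.augGF ∧
        Nonempty (EvalSectionBinder δ (galoisSubgroupOf F K Fbar)) := by
  obtain ⟨χ, hχ⟩ := D₀.exists_character_galoisSubgroupOf_ne_one
  exact D₀.exists_evalSectionBinder_regeom₃_of_character hS hA le_rfl χ hχ

/-- **EVALSECT-NV /A∘/B at `regeom₃`, `hA` DISCHARGED** by abc-iut-L5-t8's stage B part B6 (`arrowCoveringClaimsRegeom₃`, p469075): MODULO the single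
§6 binder `hS : regeom₃.CuspClassesNormaliserStable` (which has NO term at `regeom₃` — abc-iut-L5-lead RULINGS #93 (1); the stage-C model `regeom₄`
is built to carry one), `EvalSectionBinder` is inhabited at the good-place local datum over `G_K`. ([IUTchI] Ex 4.4 (i) p.106) [claim: Mochizuki2012, status: disputed] -/
theorem nonempty_evalSectionBinder_regeom₃_of_hS (hS : D₀.regeom₃.CuspClassesNormaliserStable) :
    ∃ δ : D₀.regeom₃.LocalDatum D₀.cuspGaloisRegeom₃ hS,
      δ.H = D₀.regeom₃.PiXarrow ⊓ (galoisSubgroupOf F K Fbar).comap D₀.regeom₃.augGF ∧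
        Nonempty (EvalSectionBinder δ (galoisSubgroupOf F K Fbar)) :=
  D₀.nonempty_evalSectionBinder_regeom₃ hS D₀.arrowCoveringClaimsRegeom₃

end InitialThetaData

end Regeom3

end Literature.IUT.HodgeTheaters

end
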